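import Literature.Probability.Percolation.OneArmQuasiMult
import Literature.Probability.Percolation.ArmSeparationGlue
import Literature.Probability.Percolation.ArmEventsStructure
import HarnessLib

/-!
# Quasi-multiplicativity of the one-arm ANNULUS probability at `p = 1/2` along well-spaced radii

Topic: Probability / Percolation; family `crit-perc` (critical site percolation `P = P_{1/2} =
triSitePercolation half` on the triangular lattice `𝕋`; hexagonal annuli `Λ_N ∖ Λ_n`,
`Λ_n = triBall n`, `|·|_𝕋 = triNorm`; the order-free arm events `armEvent κ n N` of
`ArmEvents.lean` and `polyArmProb κ n N = P_{1/2}(armEvent κ n N)`). A brick for the named fact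
`Literature.Probability.Percolation.Nolin2008_prop17_quasiMult` (`FiveArmExponentFacts.lean`;
P. Nolin, *Near-critical percolation in two dimensions*, EJP 13 (2008), §4.5 Prop. 17
[arXiv 0711.4948: Prop. 16]) in the case of ONE arm, `j = 1`, where — Nolin, §6.2, footnote to the
proof of Thm. 27 [arXiv Thm. 26] — "the extendability property, as well as the
quasi-multiplicativity, are direct consequences of RSW and do not require the separation lemmas".
The tree had this for the arm FROM THE ORIGIN (`triOneArm_quasiMult`, `OneArmQuasiMult.lean`,
after Lawler–Schramm–Werner 2002, §3); here it is proved for the annulus events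
`armEvent ![b] n₁ n₂`, `armEvent ![b] n₂ n₃` of the recorded fact, for both colours `b`.
Everything is PROVED; no definition and no named fact is introduced.

* `armEvent_one_of_annulus_glue` — **deterministic gluing** (LSW 2002, §3, p. 8, the inclusion
  "`C(r, R) ⊇ C(r, 2r') ∩ A(r', 2r') ∩ C(r', R)`-type" chain; Nolin §6.2 Case 1): an open arm across
  `Λ_{n₂} ∖ Λ_{n₁}`, the events `C(a,4a) ∩ A(a,2a)`, `C(2a,8a) ∩ A(2a,4a)` (`C` = open crossing,
  `A` = open circuit of the Euclidean annuli, `OneArmLSW.lean`) and an open arm across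
  `Λ_{n₃} ∖ Λ_{n₂}` meeting the circuit `A(4a, 8a)`, with `n₁ ≤ a`, `2a ≤ 0.86 n₂`, `n₂ ≤ 4a`,
  `8a ≤ 0.86 n₃`, produce an open arm across `Λ_{n₃} ∖ Λ_{n₁}` (`triOpenCircuit_glue` three
  times, then `mem_armEvent_one_of_pathIn`: last visit to `Λ_{n₁}`, first visit to `∂Λ_{n₃}`).
* `polyArmProb_one_true_quasiMult_spaced` — **the estimate**: there is `c > 0` with
  `c · P(armEvent ![T] n₁ n₂) · P(armEvent ![T] n₂ n₃) ≤ P(armEvent ![T] n₁ n₃)` for all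
  `1000 ≤ n₁`, `4 n₁ ≤ n₂`, `4 n₂ ≤ n₃` (scale `a = ⌈n₂/4⌉`; Harris chain
  `sitePercolation_real_inter_iInter_ge` for the five increasing events, RSW circuits
  `BollobasRiordan2006_openCircuit_of_rsw` and RSW crossings `exists_pos_le_triOpenCrossing_four`).
* `polyArmProb_one_quasiMult_spaced` — the same for every `κ : Fin 1 → Bool` (closed arm by
  colour exchange at `p = 1/2`, `polyArmProb_one_false`).

The general radii `n₀ ≤ n₁ < n₂ < n₃` of the recorded fact follow from this well-spaced case and
the a-priori RSW lower bound at bounded ratio (`exists_rpow_le_polyArmProb_one`,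
`ArmEventsAPriori.lean`) by the colour-blind normal form of Nolin's proof ("we may assume
`n₂ ≥ 8 n₁`"), `ArmQuasiMultNormalForm.lean`.

## References

* P. Nolin, *Near-critical percolation in two dimensions*, Electron. J. Probab. 13 (2008),
  1562–1623, §4.5 Prop. 16–17 and §6.2, proof of Thm. 27, Case 1 with its footnote
  [arXiv 0711.4948: Prop. 15–16, Thm. 26]. [Nolin2008]
* G. Lawler, O. Schramm, W. Werner, *One-arm exponent for critical 2D percolation*, Electron. J.
  Probab. 7 (2002), §3, p. 8. [LawlerSchrammWernerEJP2002]
* B. Bollobás, O. Riordan, *Percolation*, CUP (2006), Ch. 7, proof of Lemma 4 (RSW circuits).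
  [BollobasRiordan2006]

Mathlib: `Finset.prod_range_succ`, `Nat.ceil`; no percolation in Mathlib. Tree:
`triOpenCrossing`, `triOpenCircuit`, `triOpenCircuit_glue`, `mem_triOpenCrossing_iff`,
`determinedBy_triOpenCrossing`, `determinedBy_triOpenCircuit`, `isUpperSet_triOpenCrossing`,
`isUpperSet_triOpenCircuit`, `mem_box_of_norm_triEmbed_le`, `subset_box_of_norm_le`,
`norm_triEmbed_le_triNorm`, `mul_triNorm_le_norm_triEmbed`, `sitePercolation_real_inter_iInter_ge`
(`OneArmLSW.lean`); `BollobasRiordan2006_openCircuit_of_rsw` (`TriAnnulusCircuit.lean`);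
`exists_pos_le_triOpenCrossing_four` (`OneArmQuasiMult.lean`); `tri_rsw_half_holds`
(`TriThetaHalf.lean`); `mem_armEvent_one_iff_exists_pathIn`, `const_lt_sqrt_three_div_two`
(`ArmEventsAPriori.lean`); `mem_armEvent_one_of_pathIn` (`ArmSeparationGlue.lean`);
`isUpperSet_armEvent`, `determinedBy_armEvent`, `polyArmProb_one_false`
(`ArmEventsStructure.lean`); `sitePercolation_harris` (`SitePercolationMeasure.lean`).
-/

noncomputable section

open MeasureTheory Set

namespace Literature.Probability.Percolation

open LatticeModels

/-! ### Deterministic gluing of two annulus arms through three RSW circuits -/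

/-- A site of `∂Λ_n` has Euclidean norm at most `n`. [folklore] -/
theorem norm_triEmbed_le_of_mem_triSphere {n : ℕ} {x : Site 2} (hx : x ∈ triSphere n) :
    ‖triEmbed x‖ ≤ n := by
  have h := norm_triEmbed_le_triNorm x
  rw [mem_triSphere_iff] at hx
  rw [hx] at h
  exact_mod_cast h

/-- A site of `∂Λ_n` has Euclidean norm at least `0.86 n` (`√3/2 > 0.86`). [folklore] -/
theorem mul_le_norm_triEmbed_of_mem_triSphere {n : ℕ} {y : Site 2} (hy : y ∈ triSphere n) :
    86 / 100 * (n : ℝ) ≤ ‖triEmbed y‖ := by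
  have h := mul_triNorm_le_norm_triEmbed y
  rw [mem_triSphere_iff] at hy
  rw [hy] at h
  push_cast at h
  have h3 := const_lt_sqrt_three_div_two
  have hn : (0 : ℝ) ≤ n := Nat.cast_nonneg n
  nlinarith

/-- An arm of `armEvent ![true] r R` as an open `𝕋`-path between its endpoints. [cite: SmirnovWernerMRL2001, §3] -/
theorem exists_pathIn_of_mem_armEvent_one_true {r R : ℕ} (hrR : r ≤ R) {ω : SiteConfig (Site 2)}
    (h : ω ∈ armEvent ![true] r R) :
    ∃ x ∈ triSphere r, ∃ y ∈ triSphere R, PathIn triGraph ω x y := by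
  obtain ⟨x, hx, y, hy, hp⟩ := (mem_armEvent_one_iff_exists_pathIn hrR).1 h
  refine ⟨x, hx, y, hy, hp.mono ?_⟩
  rintro v ⟨-, hv⟩
  simpa using hv

/-- **Deterministic gluing** (Lawler–Schramm–Werner 2002, §3, p. 8; Nolin 2008, §6.2, Case 1, for
annulus arms): with `n₁ ≤ n₂ ≤ n₃`, `n₁ ≤ a`, `2a ≤ 0.86 n₂`, `n₂ ≤ 4a`, `8a ≤ 0.86 n₃`, on
`armEvent ![T] n₁ n₂ ∩ [C(a,4a) ∩ A(a,2a)] ∩ [C(2a,8a) ∩ A(2a,4a)] ∩ [armEvent ![T] n₂ n₃ ∩ A(4a,8a)]`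
there is an open arm across `Λ_{n₃} ∖ Λ_{n₁}`: the inner arm runs from `‖·‖ ≤ n₁ ≤ a` to
`‖·‖ ≥ 0.86 n₂ ≥ 2a`, so it meets the circuit `A(a,2a)`, as does `C(a,4a)`; the latter and
`C(2a,8a)` meet `A(2a,4a)`; `C(2a,8a)` and the outer arm (from `‖·‖ ≤ n₂ ≤ 4a` to
`‖·‖ ≥ 0.86 n₃ ≥ 8a`) meet `A(4a,8a)`; the resulting open path from `∂Λ_{n₁}` to `∂Λ_{n₃}` contains an
arm of the annulus (`mem_armEvent_one_of_pathIn`). [cite: LawlerSchrammWernerEJP2002, §3 (p. 8)] [cite: Nolin2008, §6.2, proof of Thm. 27, Case 1 (arXiv 0711.4948: Thm. 26)] -/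
theorem armEvent_one_of_annulus_glue {a : ℝ} {n₁ n₂ n₃ : ℕ} (h₁₂ : n₁ ≤ n₂) (h₂₃ : n₂ ≤ n₃)
    (hn₁ : (n₁ : ℝ) ≤ a) (hn₂ : 2 * a ≤ 86 / 100 * (n₂ : ℝ)) (hn₂' : (n₂ : ℝ) ≤ 4 * a)
    (hn₃ : 8 * a ≤ 86 / 100 * (n₃ : ℝ)) {ω : SiteConfig (Site 2)}
    (hE : ω ∈ armEvent ![true] n₁ n₂)
    (h0 : ω ∈ triOpenCrossing a (4 * a) ∩ triOpenCircuit a (2 * a))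
    (h1 : ω ∈ triOpenCrossing (2 * a) (8 * a) ∩ triOpenCircuit (2 * a) (4 * a))
    (h2 : ω ∈ armEvent ![true] n₂ n₃ ∩ triOpenCircuit (4 * a) (8 * a)) :
    ω ∈ armEvent ![true] n₁ n₃ := by
  obtain ⟨x₁, hx₁, y₁, hy₁, p₁⟩ := exists_pathIn_of_mem_armEvent_one_true h₁₂ hE
  obtain ⟨x₂, hx₂, y₂, hy₂, p₂⟩ := exists_pathIn_of_mem_armEvent_one_true h₂₃ h2.1
  obtain ⟨x', y', hx', hy', p'⟩ := mem_triOpenCrossing_iff.1 h0.1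
  obtain ⟨x'', y'', hx'', hy'', p''⟩ := mem_triOpenCrossing_iff.1 h1.1
  have nx₁ : ‖triEmbed x₁‖ ≤ a := (norm_triEmbed_le_of_mem_triSphere hx₁).trans hn₁
  have ny₁ : 2 * a ≤ ‖triEmbed y₁‖ := hn₂.trans (mul_le_norm_triEmbed_of_mem_triSphere hy₁)
  have nx₂ : ‖triEmbed x₂‖ ≤ 4 * a := (norm_triEmbed_le_of_mem_triSphere hx₂).trans hn₂'
  have ny₂ : 8 * a ≤ ‖triEmbed y₂‖ := hn₃.trans (mul_le_norm_triEmbed_of_mem_triSphere hy₂)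
  have q₁ : PathIn triGraph ω x₁ y' :=
    triOpenCircuit_glue h0.2 nx₁ ny₁ p₁ hx'.le (by linarith) p'
  have q₂ : PathIn triGraph ω x₁ y'' :=
    triOpenCircuit_glue h1.2 (by linarith) (by linarith) q₁ hx''.le (by linarith) p''
  have q₃ : PathIn triGraph ω x₁ y₂ :=
    triOpenCircuit_glue h2.2 (by linarith) (by linarith) q₂ nx₂ ny₂ p₂
  rw [mem_triSphere_iff] at hx₁ hy₂
  exact mem_armEvent_one_of_pathIn q₃ hx₁.le hy₂.ge (h₁₂.trans h₂₃)

/-! ### The estimate -/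

/-- **Quasi-multiplicativity of the open one-arm annulus probability along well-spaced radii**
(Nolin 2008, §4.5 Prop. 17 [arXiv 0711.4948: Prop. 16] for `j = 1`, "a direct consequence of RSW";
LSW 2002, §3): there is `c > 0` with
`c · P_{1/2}(armEvent ![T] n₁ n₂) · P_{1/2}(armEvent ![T] n₂ n₃) ≤ P_{1/2}(armEvent ![T] n₁ n₃)` for
all `1000 ≤ n₁`, `4 n₁ ≤ n₂`, `4 n₂ ≤ n₃`. With `a = ⌈n₂ / 4⌉` the five increasing events of
`armEvent_one_of_annulus_glue` are determined by one finite box, so Harris' inequality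
(`sitePercolation_real_inter_iInter_ge`, `sitePercolation_harris`) bounds the probability of their
intersection below by the product; the three circuits and two crossings have probability bounded
below by RSW (`BollobasRiordan2006_openCircuit_of_rsw`, `exists_pos_le_triOpenCrossing_four`). [cite: Nolin2008, §4.5 Prop. 17 (arXiv 0711.4948: Prop. 16), j = 1] [cite: LawlerSchrammWernerEJP2002, §3 (p. 8)] -/
theorem polyArmProb_one_true_quasiMult_spaced :
    ∃ c : ℝ, 0 < c ∧ ∀ n₁ n₂ n₃ : ℕ, 1000 ≤ n₁ → 4 * n₁ ≤ n₂ → 4 * n₂ ≤ n₃ →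
      c * (polyArmProb ![true] n₁ n₂ * polyArmProb ![true] n₂ n₃) ≤ polyArmProb ![true] n₁ n₃ := by
  obtain ⟨cA, hcA, hA⟩ := BollobasRiordan2006_openCircuit_of_rsw tri_rsw_half_holds
  obtain ⟨cX, hcX, hX⟩ := exists_pos_le_triOpenCrossing_four
  refine ⟨(cX * cA) * (cX * cA) * cA, by positivity, fun n₁ n₂ n₃ hn₁ h₁₂ h₂₃ => ?_⟩
  -- the scale `a = ⌈n₂ / 4⌉`
  obtain ⟨a, ha⟩ : ∃ a : ℕ, a = (n₂ + 3) / 4 := ⟨_, rfl⟩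
  have ha1000 : 1000 ≤ a := by omega
  have hn₁a : n₁ ≤ a := by omega
  have hn₂a : n₂ ≤ 4 * a := by omega
  have h8a : 8 * a ≤ 2 * n₂ + 6 := by omega
  have ha0 : (0 : ℝ) < a := by exact_mod_cast (show 0 < a by omega)
  have ha' : (1000 : ℝ) ≤ a := by exact_mod_cast ha1000
  have hn₁r : (n₁ : ℝ) ≤ a := by exact_mod_cast hn₁a
  have hn₂r : (n₂ : ℝ) ≤ 4 * a := by exact_mod_cast hn₂a
  have h8ar : (8 : ℝ) * a ≤ 2 * n₂ + 6 := by exact_mod_cast h8a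
  have hn₂big : (4000 : ℝ) ≤ n₂ := by exact_mod_cast (show 4000 ≤ n₂ by omega)
  have hn₃r : (4 : ℝ) * n₂ ≤ n₃ := by exact_mod_cast h₂₃
  have h2a : 2 * (a : ℝ) ≤ 86 / 100 * (n₂ : ℝ) := by linarith
  have h8a' : 8 * (a : ℝ) ≤ 86 / 100 * (n₃ : ℝ) := by linarith
  have h8an₃ : 8 * (a : ℝ) ≤ n₃ := by linarith
  have h₁₂' : n₁ ≤ n₂ := by omega
  have h₂₃' : n₂ ≤ n₃ := by omega
  -- the events
  set D : Set (SiteConfig (Site 2)) := armEvent ![true] n₁ n₂ with hDdef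
  set E : Set (SiteConfig (Site 2)) := armEvent ![true] n₂ n₃ with hEdef
  set Y : ℕ → Set (SiteConfig (Site 2)) := fun j =>
    if j = 0 then triOpenCrossing (a : ℝ) (4 * a) ∩ triOpenCircuit (a : ℝ) (2 * a)
    else if j = 1 then triOpenCrossing (2 * (a : ℝ)) (8 * a) ∩ triOpenCircuit (2 * (a : ℝ)) (4 * a)
    else E ∩ triOpenCircuit (4 * (a : ℝ)) (8 * a) with hYdef
  have hY0 : Y 0 = (triOpenCrossing (a : ℝ) (4 * a) ∩ triOpenCircuit (a : ℝ) (2 * a)) := by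
    simp [hYdef]
  have hY1 : Y 1 = (triOpenCrossing (2 * (a : ℝ)) (8 * a) ∩ triOpenCircuit (2 * (a : ℝ)) (4 * a)) := by
    simp [hYdef]
  have hY2 : Y 2 = (E ∩ triOpenCircuit (4 * (a : ℝ)) (8 * a)) := by
    simp [hYdef]
  -- one finite set of sites determining everything
  set R : ℝ := (n₃ : ℝ) with hR
  set F : Finset (Site 2) := box 2 ⌈2 * (R + 1)⌉₊ with hF
  have hdetC : ∀ {R₁ R₂ : ℝ}, R₁ ≤ R₂ → R₂ ≤ R → DeterminedBy (triOpenCrossing R₁ R₂) ↑F :=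
    fun hle hR₂ => (determinedBy_triOpenCrossing hle).mono
      (subset_box_of_norm_le fun v hv => hv.2.trans (by linarith))
  have hdetA : ∀ {R₁ R₂ : ℝ}, R₂ ≤ R → DeterminedBy (triOpenCircuit R₁ R₂) ↑F :=
    fun hR₂ => (determinedBy_triOpenCircuit _ _).mono
      (subset_box_of_norm_le fun v hv => hv.2.le.trans (by linarith))
  have hdetArm : ∀ {r r' : ℕ}, r ≤ r' → r' ≤ n₃ → DeterminedBy (armEvent ![true] r r') ↑F := by
    intro r r' hrr' hr'
    refine (determinedBy_armEvent ![true] hrr').mono (subset_box_of_norm_le fun v hv => ?_)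
    rw [Finset.mem_coe, mem_triAnnulus] at hv
    have h1 := norm_triEmbed_le_triNorm v
    have h2 : (triNorm v : ℝ) ≤ n₃ := by exact_mod_cast hv.2.trans (by exact_mod_cast hr')
    rw [hR]; linarith
  have hdetD : DeterminedBy D ↑F := hdetArm h₁₂' h₂₃'
  have hdetE : DeterminedBy E ↑F := hdetArm h₂₃' le_rfl
  have hupD : IsUpperSet D := isUpperSet_armEvent (fun j => by fin_cases j; rfl) _ _
  have hupE : IsUpperSet E := isUpperSet_armEvent (fun j => by fin_cases j; rfl) _ _
  have hdetY : ∀ j < 3, DeterminedBy (Y j) ↑F := by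
    intro j hj
    interval_cases j
    · rw [hY0]; exact (hdetC (by linarith) (by rw [hR]; linarith)).inter (hdetA (by rw [hR]; linarith))
    · rw [hY1]; exact (hdetC (by linarith) (by rw [hR]; linarith)).inter (hdetA (by rw [hR]; linarith))
    · rw [hY2]; exact hdetE.inter (hdetA (by rw [hR]; linarith))
  have hupY : ∀ j < 3, IsUpperSet (Y j) := by
    intro j hj
    interval_cases j
    · rw [hY0]; exact (isUpperSet_triOpenCrossing _ _).inter (isUpperSet_triOpenCircuit _ _)
    · rw [hY1]; exact (isUpperSet_triOpenCrossing _ _).inter (isUpperSet_triOpenCircuit _ _)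
    · rw [hY2]; exact hupE.inter (isUpperSet_triOpenCircuit _ _)
  -- the inclusion
  have hincl : D ∩ ⋂ j < 3, Y j ⊆ armEvent ![true] n₁ n₃ := by
    rintro ω ⟨hωD, hωY⟩
    simp only [mem_iInter] at hωY
    have h0 := hωY 0 (by norm_num); rw [hY0] at h0
    have h1 := hωY 1 (by norm_num); rw [hY1] at h1
    have h2 := hωY 2 (by norm_num); rw [hY2] at h2
    exact armEvent_one_of_annulus_glue h₁₂' h₂₃' hn₁r h2a hn₂r h8a' hωD h0 h1 h2
  -- Harris chain
  have hchain := sitePercolation_real_inter_iInter_ge half (F := F) (D := D) (Y := Y) hdetD hupD (N := 3) hdetY hupY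
  -- lower bounds for the three middle factors
  have hPA : ∀ {r : ℝ}, 1000 ≤ r → cA ≤ (sitePercolation (Site 2) half).real (triOpenCircuit r (2 * r)) :=
    fun hr => hA _ hr
  have hPX : ∀ {b : ℕ}, 6 ≤ b → cX ≤ (sitePercolation (Site 2) half).real (triOpenCrossing b (4 * b)) :=
    fun hb => hX _ hb
  have hb0 : cX * cA ≤ (sitePercolation (Site 2) half).real (Y 0) := by
    rw [hY0]
    calc cX * cA ≤ (sitePercolation (Site 2) half).real (triOpenCrossing (a : ℝ) (4 * a)) *
          (sitePercolation (Site 2) half).real (triOpenCircuit (a : ℝ) (2 * a)) :=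
          mul_le_mul (hPX (by omega)) (hPA ha') hcA.le measureReal_nonneg
      _ ≤ _ := sitePercolation_harris half (hdetC (by linarith) (by rw [hR]; linarith)) (hdetA (by rw [hR]; linarith))
          (isUpperSet_triOpenCrossing _ _) (isUpperSet_triOpenCircuit _ _)
  have hb1 : cX * cA ≤ (sitePercolation (Site 2) half).real (Y 1) := by
    rw [hY1]
    have h2a' : ((2 * a : ℕ) : ℝ) = 2 * (a : ℝ) := by push_cast; ring
    have hx := hPX (b := 2 * a) (by omega)
    rw [h2a', show (4 : ℝ) * (2 * (a : ℝ)) = 8 * a by ring] at hx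
    have hy := hPA (r := 2 * (a : ℝ)) (by linarith)
    rw [show (2 : ℝ) * (2 * (a : ℝ)) = 4 * a by ring] at hy
    calc cX * cA ≤ (sitePercolation (Site 2) half).real (triOpenCrossing (2 * (a : ℝ)) (8 * a)) *
          (sitePercolation (Site 2) half).real (triOpenCircuit (2 * (a : ℝ)) (4 * a)) :=
          mul_le_mul hx hy hcA.le measureReal_nonneg
      _ ≤ _ := sitePercolation_harris half (hdetC (by linarith) (by rw [hR]; linarith)) (hdetA (by rw [hR]; linarith))
          (isUpperSet_triOpenCrossing _ _) (isUpperSet_triOpenCircuit _ _)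
  have hb2 : (sitePercolation (Site 2) half).real E * cA ≤ (sitePercolation (Site 2) half).real (Y 2) := by
    rw [hY2]
    have hy := hPA (r := 4 * (a : ℝ)) (by linarith)
    rw [show (2 : ℝ) * (4 * (a : ℝ)) = 8 * a by ring] at hy
    calc (sitePercolation (Site 2) half).real E * cA
        ≤ (sitePercolation (Site 2) half).real E *
          (sitePercolation (Site 2) half).real (triOpenCircuit (4 * (a : ℝ)) (8 * a)) :=
          mul_le_mul_of_nonneg_left hy measureReal_nonneg
      _ ≤ _ := sitePercolation_harris half hdetE (hdetA (by rw [hR]; linarith)) hupE (isUpperSet_triOpenCircuit _ _)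
  -- assemble
  have hprod : ∏ j ∈ Finset.range 3, (sitePercolation (Site 2) half).real (Y j) =
      (sitePercolation (Site 2) half).real (Y 0) * (sitePercolation (Site 2) half).real (Y 1) *
        (sitePercolation (Site 2) half).real (Y 2) := by
    simp [Finset.prod_range_succ]
  have hDn : 0 ≤ (sitePercolation (Site 2) half).real D := measureReal_nonneg
  have hEn : 0 ≤ (sitePercolation (Site 2) half).real E := measureReal_nonneg
  show cX * cA * (cX * cA) * cA * ((sitePercolation (Site 2) half).real D * (sitePercolation (Site 2) half).real E) ≤
    (sitePercolation (Site 2) half).real (armEvent ![true] n₁ n₃)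
  calc cX * cA * (cX * cA) * cA * ((sitePercolation (Site 2) half).real D * (sitePercolation (Site 2) half).real E)
      = (sitePercolation (Site 2) half).real D *
          ((cX * cA) * (cX * cA) * ((sitePercolation (Site 2) half).real E * cA)) := by ring
    _ ≤ (sitePercolation (Site 2) half).real D * ((sitePercolation (Site 2) half).real (Y 0) *
          (sitePercolation (Site 2) half).real (Y 1) * (sitePercolation (Site 2) half).real (Y 2)) := by
        refine mul_le_mul_of_nonneg_left ?_ hDn
        have h01 : (cX * cA) * (cX * cA) ≤ (sitePercolation (Site 2) half).real (Y 0) *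
            (sitePercolation (Site 2) half).real (Y 1) :=
          mul_le_mul hb0 hb1 (by positivity) measureReal_nonneg
        exact mul_le_mul h01 hb2 (by positivity) (by positivity)
    _ = (sitePercolation (Site 2) half).real D *
          ∏ j ∈ Finset.range 3, (sitePercolation (Site 2) half).real (Y j) := by rw [hprod]
    _ ≤ (sitePercolation (Site 2) half).real (D ∩ ⋂ j < 3, Y j) := hchain
    _ ≤ (sitePercolation (Site 2) half).real (armEvent ![true] n₁ n₃) :=
        measureReal_mono hincl (measure_ne_top _ _)

/-- **Quasi-multiplicativity of the one-arm annulus probability along well-spaced radii, both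
colours** (Nolin 2008, Prop. 17 [arXiv Prop. 16], `j = 1`): for every `κ : Fin 1 → Bool` there is
`c > 0` with `c · π(n₁,n₂) π(n₂,n₃) ≤ π(n₁,n₃)` (`π = polyArmProb κ`) for all `1000 ≤ n₁`,
`4 n₁ ≤ n₂`, `4 n₂ ≤ n₃`; the closed arm by colour exchange at `p = 1/2` (`polyArmProb_one_false`). [cite: Nolin2008, §4.5 Prop. 17 (arXiv 0711.4948: Prop. 16), j = 1] [cite: SmirnovWernerMRL2001, Rem. 2] -/
theorem polyArmProb_one_quasiMult_spaced (κ : Fin 1 → Bool) :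
    ∃ c : ℝ, 0 < c ∧ ∀ n₁ n₂ n₃ : ℕ, 1000 ≤ n₁ → 4 * n₁ ≤ n₂ → 4 * n₂ ≤ n₃ →
      c * (polyArmProb κ n₁ n₂ * polyArmProb κ n₂ n₃) ≤ polyArmProb κ n₁ n₃ := by
  obtain ⟨c, hc, h⟩ := polyArmProb_one_true_quasiMult_spaced
  refine ⟨c, hc, fun n₁ n₂ n₃ h₁ h₂ h₃ => ?_⟩
  have hκ : κ = ![κ 0] := funext fun i => by fin_cases i; rfl
  rw [hκ]
  generalize κ 0 = b
  cases b
  · simpa only [polyArmProb_one_false] using h n₁ n₂ n₃ h₁ h₂ h₃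
  · exact h n₁ n₂ n₃ h₁ h₂ h₃

end Literature.Probability.Percolation

end
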